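import Summits.BirchSwinnertonDyer.BirchSwinnertonDyer.Theorems.ByReductionTypeAtTwoMultTowerNS2TateTransport
import Literature.NumberTheory.EllipticCurves.TateCurve.NumberFieldUniformization
import Literature.NumberTheory.EllipticCurves.PAdicBSDSplitMultiplicativeProofs
import Mathlib.NumberTheory.Padics.HeightOneSpectrum
import HarnessLib

/-!
# Route `ByReductionTypeAtTwo`, crux `MultUpperHalfAtTwo` (item stmt-BirchSwinnertonDyer-19922), TOWER road, the
# SPLIT rows: KERNEL BRICK S3 — the UNTWISTED Tate uniformisation at a split prime WITH its `j`-clause, the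
# identification `padicEquiv_v(q_v) = q_E` with the Tate parameter of a `TateParameterData`, and the transport
# `M_∞ = E(K̄_v)^{H_∞} = Φ(K̄_v^{H_∞})`

HONEST FRAMING (cell `bsd-2adic`, run/shared/lean/pub/bsd-2adic/, seat `bsd-2adic-mult` GEN 13, HUMAN RULINGS
D-0036 / D-0054 / D-0074): TOOL theorems only (no definition, no named fact, no `sorry`); closes nothing by itself;
nothing booked; BSD is not proved by any of this. Third brick of the KERNEL proof of the projection of the PRINT named
fact `Greenberg1999.sec3_natCard_localTowerKerPrimary_splitMultiplicative_rat` consumed by the split TOWER doors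
(`MultTowerCert.atTwo_le_pow_of_split`, whose certificate is stated on `Dq : TateParameterData W 2`, i.e. on THE Tate
parameter `q_E ∈ ℚ₂` with `tateJ q_E = j(E)`). Everything here holds at EVERY prime `p`.

* `tateE4_map` / `tateDelta_map` / `tateJ_map` — the `q`-expansions commute with a bicontinuous ring isomorphism
  (Mathlib `Function.LeftInverse.map_tsum` / `map_tprod`);
* `norm_padicEquiv_lt_one` — Mathlib's `padicEquiv v : ℚ_v ≃A[ℚ] ℚ_p` maps `{‖q‖ < 1}` into `{‖·‖ < 1}`
  (it identifies the unit balls, `adicCompletion.padicEquiv_bijOn`);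
* `exists_tateUniformisation_tateJ` — **Silverman ATAEC V.3.1 (c)(d) + V.5.3 at a SPLIT place, untwisted, with the
  `j`-clause**: `q ∈ ℚ_v`, `q ≠ 0`, `‖q‖ < 1`, `tateJ q = j(W)`, `Φ : K̄_vˣ ↠ E(K̄_v)` with kernel `q^ℤ` and
  `σ • Φ(u) = Φ(σu)` (the tree's `Silverman1994_thmV53_tateUniformisation_holds` keeps everything but the `j`-clause;
  same assembly from `exists_tateParameter_of_hasSplitMultiplicativeReductionAt` + `uniformization_holds`);
* `padicEquiv_eq_tateParameter` — **`padicEquiv_v(q) = Dq.q`** for `v ∋ p` and `Dq : TateParameterData W p` (Tate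
  parameter uniqueness `eq_of_tateJ_eq` in `ℚ_p`, ATAEC Lemma V.5.1);
* `exists_unit_of_mem_fixedPoints_split` / `apply_mem_fixedPoints_split` — `M_∞ = Φ({x : ∀ h ∈ H_∞, hx = x})`
  (orbit finiteness, tower-1's `smul_eq_self_of_smul_eq_zpow_mul`; untwisted form of tower-1's BRICK 18).

References: J. Silverman, GTM 151, Lemma V.5.1, Thm. V.3.1 (c)(d), Thm. V.5.3; R. Greenberg, LNM 1716 (1999), §3
pp. 90–93; cell memo HOME/mult/NOTE-SP1ONE.md §5.
-/

set_option autoImplicit false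
-- the Theorems namespace of this sub repeats the summit name by design (D-0017 nested layout: Summit.<S>.<Sub>)
set_option linter.dupNamespace false

noncomputable section

open scoped Classical

namespace Summit.BirchSwinnertonDyer.BirchSwinnertonDyer.Theorems.MultTowerSplitOrder

open NumberField IsDedekindDomain Field WeierstrassCurve Rat.HeightOneSpectrum
  Literature.NumberTheory.EllipticCurves Literature.NumberTheory.EllipticCurves.TateCurve
  Literature.NumberTheory.GaloisRepresentations
  Summit.BirchSwinnertonDyer.BirchSwinnertonDyer.Theorems.MultTowerNS2

attribute [local instance]
  Literature.NumberTheory.GaloisRepresentations.Ultrametric.AdicCompletion.nontriviallyNormedField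

/-! ### The `q`-expansions commute with bicontinuous ring isomorphisms -/

section MapSeries

variable {K L : Type*} [NormedField K] [NormedField L]

/-- `E₄(e q) = e(E₄(q))` for a bicontinuous ring isomorphism `e`. [folklore] -/
theorem tateE4_map (e : K ≃+* L) (he : Continuous e) (he' : Continuous e.symm) (q : K) :
    tateE4 (e q) = e (tateE4 q) := by
  unfold tateE4
  rw [map_add, map_one, map_mul, map_ofNat,
    Function.LeftInverse.map_tsum (fun n : ℕ ↦ ((ArithmeticFunction.sigma 3 (n + 1) : ℕ) : K) * q ^ (n + 1))
      he he' e.symm_apply_apply]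
  congr 2
  refine tsum_congr fun n ↦ ?_
  rw [map_mul, map_natCast, map_pow]

/-- `Δ(e q) = e(Δ(q))` for a bicontinuous ring isomorphism `e`. [folklore] -/
theorem tateDelta_map (e : K ≃+* L) (he : Continuous e) (he' : Continuous e.symm) (q : K) :
    tateDelta (e q) = e (tateDelta q) := by
  unfold tateDelta
  rw [map_mul, Function.LeftInverse.map_tprod (fun n : ℕ ↦ (1 - q ^ (n + 1)) ^ 24) he he' e.symm_apply_apply]
  congr 1
  refine tprod_congr fun n ↦ ?_
  rw [map_pow, map_sub, map_one, map_pow]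

/-- `j(e q) = e(j(q))` for a bicontinuous ring isomorphism `e`. [folklore] -/
theorem tateJ_map (e : K ≃+* L) (he : Continuous e) (he' : Continuous e.symm) (q : K) :
    tateJ (e q) = e (tateJ q) := by
  unfold tateJ
  rw [tateE4_map e he he', tateDelta_map e he he', map_div₀, map_pow]

end MapSeries

/-! ### Mathlib's `padicEquiv` on the open unit ball -/

/-- **`‖q‖ < 1 ⇒ ‖padicEquiv_v q‖ < 1`**: `padicEquiv v` identifies the unit balls `𝒪_v` and `ℤ_p`
(`adicCompletion.padicEquiv_bijOn`); an element of norm `< 1` with image a unit would have its inverse in `𝒪_v`.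
[folklore] -/
theorem norm_padicEquiv_lt_one (v : HeightOneSpectrum (𝓞 ℚ)) {q : v.adicCompletion ℚ} (hq0 : q ≠ 0)
    (hq : ‖q‖ < 1) :
    haveI := Fact.mk (primesEquiv v).2
    ‖(adicCompletion.padicEquiv (R := 𝓞 ℚ) v) q‖ < 1 := by
  haveI := Fact.mk (primesEquiv v).2
  have hbij := adicCompletion.padicEquiv_bijOn (R := 𝓞 ℚ) v
  have hint : ∀ x : v.adicCompletion ℚ, ‖x‖ ≤ 1 → ‖(adicCompletion.padicEquiv (R := 𝓞 ℚ) v) x‖ ≤ 1 := by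
    intro x hx
    have hx' : x ∈ v.adicCompletionIntegers ℚ :=
      (HeightOneSpectrum.mem_adicCompletionIntegers (𝓞 ℚ) ℚ v).mpr
        ((Valued.toNormedField.norm_le_one_iff).mp hx)
    exact (hbij.1 hx' : _ ∈ PadicInt.subring _)
  have hle := hint q hq.le
  rcases lt_or_eq_of_le hle with h | h
  · exact h
  · exfalso
    -- the image is a unit of `ℤ_p`, so `q⁻¹ ∈ 𝒪_v`, contradicting `‖q‖ < 1`
    set Q := (adicCompletion.padicEquiv (R := 𝓞 ℚ) v) q with hQ
    have hQ0 : Q ≠ 0 := by rw [hQ]; exact (map_ne_zero _).mpr hq0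
    have hQi : ‖Q⁻¹‖ ≤ 1 := by rw [norm_inv, h, inv_one]
    have hmem : Q⁻¹ ∈ PadicInt.subring (primesEquiv v : ℕ) := hQi
    obtain ⟨y, hy, hyQ⟩ := hbij.2.2 hmem
    have hyq : y = q⁻¹ := by
      have h' : (adicCompletion.padicEquiv (R := 𝓞 ℚ) v) y = (adicCompletion.padicEquiv (R := 𝓞 ℚ) v) q⁻¹ := by
        rw [hyQ, hQ, map_inv₀]
      exact (adicCompletion.padicEquiv (R := 𝓞 ℚ) v).injective h'
    have hqi : ‖q⁻¹‖ ≤ 1 := by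
      rw [← hyq]
      exact (Valued.toNormedField.norm_le_one_iff).mpr
        ((HeightOneSpectrum.mem_adicCompletionIntegers (𝓞 ℚ) ℚ v).mp hy)
    rw [norm_inv] at hqi
    have h1 : 1 ≤ ‖q‖ := by
      by_contra hlt
      push Not at hlt
      have hpos : 0 < ‖q‖ := norm_pos_iff.mpr hq0
      have : 1 < ‖q‖⁻¹ := (one_lt_inv₀ hpos).mpr hlt
      linarith
    linarith

/-! ### The untwisted Tate uniformisation with its `j`-clause -/

/-- **Silverman ATAEC Thm. V.3.1 (c)(d) + Thm. V.5.3 at a place of SPLIT multiplicative reduction, untwisted, WITH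
the `j`-clause.** For `W/ℚ` elliptic with split multiplicative reduction at the finite place `v`: there are `q ∈ ℚ_v`
with `q ≠ 0`, `‖q‖ < 1`, `tateJ q = j(W)`, and a surjective homomorphism `Φ : K̄_vˣ → E(K̄_v)` with kernel `q^ℤ`,
`Γ_{ℚ_v}`-equivariant (`σ • Φ(u) = Φ(σu)`). Same assembly as the tree's `Silverman1994_thmV53_tateUniformisation_holds`
(which discards the `j`-clause): `exists_tateParameter_of_hasSplitMultiplicativeReductionAt` + `uniformization_holds`
+ `localPointsEquivTate`. [cite: SilvermanATAEC1994, Thm. V.5.3 (PDF pp. 407–409) and Thm. V.3.1 (c)(d) (PDF p. 395)] -/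
theorem exists_tateUniformisation_tateJ (W : WeierstrassCurve ℚ) [W.IsElliptic] (v : HeightOneSpectrum (𝓞 ℚ))
    (hsplit : W.HasSplitMultiplicativeReductionAt v) :
    ∃ (q : v.adicCompletion ℚ)
      (Φ : Additive (AlgebraicClosure (v.adicCompletion ℚ))ˣ →+ localPoints W (v.adicCompletion ℚ)),
      q ≠ 0 ∧ ‖q‖ < 1 ∧ tateJ q = algebraMap ℚ (v.adicCompletion ℚ) W.j ∧
      Function.Surjective Φ ∧
      (∀ u : (AlgebraicClosure (v.adicCompletion ℚ))ˣ, Φ (Additive.ofMul u) = 0 ↔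
        ∃ n : ℤ, (u : AlgebraicClosure (v.adicCompletion ℚ)) =
          algebraMap (v.adicCompletion ℚ) (AlgebraicClosure (v.adicCompletion ℚ)) q ^ n) ∧
      (∀ (σ : absoluteGaloisGroup (v.adicCompletion ℚ)) (u : (AlgebraicClosure (v.adicCompletion ℚ))ˣ),
        σ • Φ (Additive.ofMul u) =
          Φ (Additive.ofMul (Units.map
            (absoluteGaloisGroup.toAlgEquiv (v.adicCompletion ℚ) σ :
              AlgebraicClosure (v.adicCompletion ℚ) →* AlgebraicClosure (v.adicCompletion ℚ)) u))) := by
  haveI := charZero_adicCompletion' ℚ v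
  obtain ⟨q, hq0, hq, hqj, -, C, hC⟩ := exists_tateParameter_of_hasSplitMultiplicativeReductionAt ℚ v W hsplit
  obtain ⟨φ, hsurj, hker, hequiv, -⟩ := uniformization_holds q hq0 hq
  let e := localPointsEquivTate W v C hC
  refine ⟨q, e.symm.toAddMonoidHom.comp φ, hq0, hq, hqj, e.symm.surjective.comp hsurj, ?_, ?_⟩
  · intro u
    rw [← hker u]
    change e.symm (φ (Additive.ofMul u)) = 0 ↔ _
    rw [AddEquiv.map_eq_zero_iff]
  · intro σ u
    change σ • e.symm (φ (Additive.ofMul u)) = e.symm (φ _)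
    rw [← hequiv σ u]
    apply e.injective
    rw [AddEquiv.apply_symm_apply, localPointsEquivTate_smul, AddEquiv.apply_symm_apply]

/-! ### `padicEquiv_v(q) = q_E` -/

/-- **The local Tate parameter IS the Tate parameter of the datum.** For `v ∋ p`, `q ∈ ℚ_v` with `q ≠ 0`, `‖q‖ < 1`,
`tateJ q = j(W)`, and `Dq : TateParameterData W p` (`p = primesEquiv v`): `padicEquiv_v(q) = Dq.q` in `ℚ_p` —
`padicEquiv_v` is a bicontinuous `ℚ`-algebra isomorphism, so `tateJ(padicEquiv_v q) = padicEquiv_v(tateJ q) = j(W)` and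
`‖padicEquiv_v q‖ < 1`; conclude by the uniqueness of the Tate parameter (ATAEC Lemma V.5.1, the tree's
`eq_of_tateJ_eq`). [cite: SilvermanATAEC1994, Lemma V.5.1 (PDF p. 406)] -/
theorem padicEquiv_eq_tateParameter (W : WeierstrassCurve ℚ) [W.IsElliptic] (v : HeightOneSpectrum (𝓞 ℚ))
    {q : v.adicCompletion ℚ} (hq0 : q ≠ 0) (hq : ‖q‖ < 1)
    (hqj : tateJ q = algebraMap ℚ (v.adicCompletion ℚ) W.j) :
    haveI := Fact.mk (primesEquiv v).2
    ∀ Dq : TateParameterData W (primesEquiv v : ℕ), (adicCompletion.padicEquiv (R := 𝓞 ℚ) v) q = Dq.q := by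
  haveI := Fact.mk (primesEquiv v).2
  intro Dq
  set e := adicCompletion.padicEquiv (R := 𝓞 ℚ) v with he
  have hQ0 : e q ≠ 0 := (map_ne_zero _).mpr hq0
  have hQ1 : ‖e q‖ < 1 := norm_padicEquiv_lt_one v hq0 hq
  have hQj : tateJ (e q) = (W.j : ℚ_[(primesEquiv v : ℕ)]) := by
    have h := tateJ_map (e : v.adicCompletion ℚ ≃A[ℚ] ℚ_[(primesEquiv v : ℕ)]).toAlgEquiv.toRingEquiv
      e.continuous e.symm.continuous q
    change tateJ (e q) = e.toAlgEquiv.toRingEquiv (tateJ q) at h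
    rw [h, hqj]
    change e.toAlgEquiv (algebraMap ℚ (v.adicCompletion ℚ) W.j) = _
    rw [AlgEquiv.commutes, eq_ratCast]
  exact eq_of_tateJ_eq hQ0 hQ1 Dq.q_ne_zero Dq.norm_q_lt_one (hQj.trans Dq.tateJ_eq.symm)

/-! ### Transport: `M_∞ = Φ(K̄_v^{H_∞})` -/

section Transport

variable {p : ℕ} [Fact p.Prime] {κ : ZpExtension ℚ p} (v : HeightOneSpectrum (𝓞 ℚ)) {W : WeierstrassCurve ℚ}
  {Φ : Additive (AlgebraicClosure (v.adicCompletion ℚ))ˣ →+ localPoints W (v.adicCompletion ℚ)}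
  {Q : AlgebraicClosure (v.adicCompletion ℚ)}

/-- **`M_∞ ⊆ Φ(K̄_v^{H_∞})`** (untwisted): a point of `E(K̄_v)` fixed by `H_∞` is `Φ(x)` with `x` fixed by `H_∞` —
`Φ(x) = hΦ(x) = Φ(hx)` gives `hx = Q^j x`, and `hx = x` by orbit finiteness. [cite: GreenbergLNM1716, §3 (pp. 90–93)]
[cite: SilvermanATAEC1994, Thm. V.3.1 (c)(d), Thm. V.5.3] -/
theorem exists_unit_of_mem_fixedPoints_split (hsurj : Function.Surjective Φ)
    (hker : ∀ u : (AlgebraicClosure (v.adicCompletion ℚ))ˣ, Φ (Additive.ofMul u) = 0 ↔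
      ∃ j : ℤ, (u : AlgebraicClosure (v.adicCompletion ℚ)) = Q ^ j)
    (hequiv : ∀ (σ : absoluteGaloisGroup (v.adicCompletion ℚ)) (u u' : (AlgebraicClosure (v.adicCompletion ℚ))ˣ),
      (u' : AlgebraicClosure (v.adicCompletion ℚ)) = σ • (u : AlgebraicClosure (v.adicCompletion ℚ)) →
        σ • Φ (Additive.ofMul u) = Φ (Additive.ofMul u'))
    (hQfix : ∀ σ : absoluteGaloisGroup (v.adicCompletion ℚ), σ • Q = Q) (hQ0 : Q ≠ 0)
    (hQtor : ∀ j : ℤ, Q ^ j = 1 → j = 0)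
    {m : localPoints W (v.adicCompletion ℚ)}
    (hm : ∀ h ∈ localSubgroup κ.kerSubgroup (v.adicCompletion ℚ), h • m = m) :
    ∃ x : (AlgebraicClosure (v.adicCompletion ℚ))ˣ, Φ (Additive.ofMul x) = m ∧
      ∀ h ∈ localSubgroup κ.kerSubgroup (v.adicCompletion ℚ),
        h • (x : AlgebraicClosure (v.adicCompletion ℚ)) = x := by
  obtain ⟨x', hx'⟩ := hsurj m
  set x : (AlgebraicClosure (v.adicCompletion ℚ))ˣ := Additive.toMul x' with hx
  have hxm : Φ (Additive.ofMul x) = m := by rw [hx, ofMul_toMul]; exact hx'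
  refine ⟨x, hxm, fun h hh ↦ ?_⟩
  set u' : (AlgebraicClosure (v.adicCompletion ℚ))ˣ :=
    Units.mk0 (h • (x : AlgebraicClosure (v.adicCompletion ℚ))) ((smul_ne_zero_iff_ne h).mpr x.ne_zero) with hu'
  have h1 := hequiv h x u' rfl
  rw [hxm, hm h hh] at h1
  -- `Φ x = Φ (h x)`: `h x = Q^j x`
  rw [← hxm, tatePsi_eq_iff v hker] at h1
  obtain ⟨j, hj⟩ := h1
  have hj' : h • (x : AlgebraicClosure (v.adicCompletion ℚ)) = Q ^ (-j) * x := by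
    rw [zpow_neg, ← Units.val_mk0 ((smul_ne_zero_iff_ne h).mpr x.ne_zero), ← hu', hj]
    field_simp
  exact smul_eq_self_of_smul_eq_zpow_mul v (hQfix h) hQ0 hQtor x.ne_zero hj'

/-- **`Φ(K̄_v^{H}) ⊆ E(K̄_v)^{H}`** (untwisted, any subgroup `H`): if `x` is fixed by `H` then so is `Φ(x)`.
[cite: SilvermanATAEC1994, Thm. V.3.1 (c)(d), Thm. V.5.3] -/
theorem apply_mem_fixedPoints_split
    (hequiv : ∀ (σ : absoluteGaloisGroup (v.adicCompletion ℚ)) (u u' : (AlgebraicClosure (v.adicCompletion ℚ))ˣ),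
      (u' : AlgebraicClosure (v.adicCompletion ℚ)) = σ • (u : AlgebraicClosure (v.adicCompletion ℚ)) →
        σ • Φ (Additive.ofMul u) = Φ (Additive.ofMul u'))
    (H : Subgroup (absoluteGaloisGroup (v.adicCompletion ℚ)))
    {x : (AlgebraicClosure (v.adicCompletion ℚ))ˣ}
    (hx : ∀ h ∈ H, h • (x : AlgebraicClosure (v.adicCompletion ℚ)) = x) :
    ∀ h ∈ H, h • Φ (Additive.ofMul x) = Φ (Additive.ofMul x) :=
  fun h hh ↦ hequiv h x x (hx h hh).symm

end Transport

end Summit.BirchSwinnertonDyer.BirchSwinnertonDyer.Theorems.MultTowerSplitOrder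

end
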